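import Mathlib
import Summits.NavierStokesRegularity.NavierStokesRegularity.Theorems.SubOnsagerCeilingKPDeadEndPumpBarrier
import Summits.NavierStokesRegularity.NavierStokesRegularity.Theorems.SubOnsagerCeilingKPLeakSprayBarrier
import Summits.NavierStokesRegularity.NavierStokesRegularity.Theorems.OrthantWakeOrthantTableStructure
import HarnessLib

/-!
# The energy-starvation corners are NOT VACUOUS: admissible tables of `E₂(4)` in both classes
# (helper file for the crux `SubOnsagerCeiling.ForwardTailCeilingKP`, stmt-NavierStokesRegularity-27057, `--supports`)

Companion of `Theorems/SubOnsagerCeilingKPDeadEndPump{Starvation,Barrier}.lean` and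
`Theorems/SubOnsagerCeilingKPLeakSpray{Starvation,Barrier}.lean`.  Those corners are stated for KP networks proper by
coefficient hypotheses; this file shows that such tables EXIST inside the crux's hypotheses (symmetric (4.2), cancelling
(4.3), `4`-comparable, ORTHANT, diagonal feeds) with weights in the starvation range at EVERY `ε₀ ∈ (0, 1]`:

* §1 the DEAD-END PUMP table with chain weight `c₀ = 1/2` and pump weight `P = 1` (`P²/c₀² = 4 > ε₀`):
  `deadEndPump_nonempty` (class membership proved inline, 64-case checks), and the barrier instantiated on it
  (`deadEndPump_nonempty_shellBarrierAt`: `ShellBarrierAt R ε₀ α` for every `R` and every `ε₀ ∈ (0,1]`);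
* §2 the LEAK-SPRAY table with chain weight `W 0 = 1/2` and one leak `W 1 = 1` (`r = 4 > ε₀`):
  `leakSpray_nonempty`, `leakSpray_nonempty_shellBarrierAt`.

HONEST FRAMING: MODEL lattice algebra (route SubOnsagerCeiling, rung TL-M2Break); no stub, crux or summit is proved and
nothing here bears on Navier–Stokes regularity. [cite: Tao2016AveragedNS, §4 (4.2)–(4.3)]
-/

noncomputable section

-- the sub-problem namespace `NavierStokesRegularity.NavierStokesRegularity` is the tree's layout (D-0017)
set_option linter.dupNamespace false

namespace Summit.NavierStokesRegularity.NavierStokesRegularity.Theorems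

open Literature.Analysis.FluidPDE.TaoCascade
open Summit.NavierStokesRegularity.NavierStokesRegularity.Theorems.SubOnsagerCeiling

/-! ## §1 The dead-end pump table `c₀ = 1/2`, `P = 1` -/

/-- **THE DEAD-END PUMP CLASS IS NON-EMPTY INSIDE THE CRUX'S HYPOTHESES, IN THE STARVATION RANGE**: a table of `E₂(4)`
(symmetric (4.2), cancelling (4.3), `4`-comparable), orthant (via `orthant_iff_coefficients`), with diagonal feeds,
chain weight `c₀ = 1/2` and dead-end pump weight `P = 1` (`P²/c₀² = 4 > ε₀` for every `ε₀ ≤ 1`). [this file] -/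
theorem deadEndPump_nonempty : ∃ α : Fin 4 → Fin 4 → Fin 4 → ℤ × ℤ × ℤ → ℝ,
    Literature.Analysis.FluidPDE.TaoCascade.InTableClass 4 α ∧
    (∀ (Y : Fin 4 → ℤ → ℝ → ℝ) (τ : ℝ), (∀ (j : Fin 4) (k : ℤ), 1 ≤ k → 0 ≤ Y j k τ) →
      ∀ δ : ℝ, 0 < δ → ∀ (i : Fin 4) (n : ℤ), 1 ≤ n → Y i n τ = 0 → 0 ≤ quadTerm δ α Y i n τ) ∧
    (∀ a b i : Fin 4, a ≠ b → α a b i (0, 0, 1) = 0) ∧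
    (∀ a c : Fin 4, α a a c (0, 0, 1) = if a = 0 ∧ c = 0 then (1 / 2 : ℝ) else 0) ∧
    (∀ a c : Fin 4, a ≠ c → α a a c (0, 0, 0) = if a = 0 ∧ c = 1 then (1 : ℝ) else 0) ∧
    (∀ a b c : Fin 4, a ≠ b → a ≠ c → b ≠ c → α a b c (0, 0, 0) = 0) := by
  set α : Fin 4 → Fin 4 → Fin 4 → ℤ × ℤ × ℤ → ℝ := fun i₁ i₂ i₃ μ =>
    if μ = ((0 : ℤ), (0 : ℤ), (1 : ℤ)) then (if i₁ = 0 ∧ i₂ = 0 ∧ i₃ = 0 then (1 / 2 : ℝ) else 0)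
    else if μ = ((1 : ℤ), (0 : ℤ), (0 : ℤ)) then (if i₁ = 0 ∧ i₂ = 0 ∧ i₃ = 0 then (-(1 / 4) : ℝ) else 0)
    else if μ = ((0 : ℤ), (1 : ℤ), (0 : ℤ)) then (if i₁ = 0 ∧ i₂ = 0 ∧ i₃ = 0 then (-(1 / 4) : ℝ) else 0)
    else if μ = ((0 : ℤ), (0 : ℤ), (0 : ℤ)) then
      ((if i₁ = 0 ∧ i₂ = 0 ∧ i₃ = 1 then (1 : ℝ) else 0) +
        (if ((i₁ = 0 ∧ i₂ = 1) ∨ (i₁ = 1 ∧ i₂ = 0)) ∧ i₃ = 0 then -(1 / 2) else 0))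
    else 0 with hα
  have hfeed : ∀ i₁ i₂ i₃ : Fin 4, α i₁ i₂ i₃ ((0 : ℤ), (0 : ℤ), (1 : ℤ)) =
      if i₁ = 0 ∧ i₂ = 0 ∧ i₃ = 0 then (1 / 2 : ℝ) else 0 := fun _ _ _ => by simp [hα]
  have hup1 : ∀ i₁ i₂ i₃ : Fin 4, α i₁ i₂ i₃ ((1 : ℤ), (0 : ℤ), (0 : ℤ)) =
      if i₁ = 0 ∧ i₂ = 0 ∧ i₃ = 0 then (-(1 / 4) : ℝ) else 0 := fun _ _ _ => by simp [hα]
  have hup2 : ∀ i₁ i₂ i₃ : Fin 4, α i₁ i₂ i₃ ((0 : ℤ), (1 : ℤ), (0 : ℤ)) =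
      if i₁ = 0 ∧ i₂ = 0 ∧ i₃ = 0 then (-(1 / 4) : ℝ) else 0 := fun _ _ _ => by simp [hα]
  have hin : ∀ i₁ i₂ i₃ : Fin 4, α i₁ i₂ i₃ ((0 : ℤ), (0 : ℤ), (0 : ℤ)) =
      (if i₁ = 0 ∧ i₂ = 0 ∧ i₃ = 1 then (1 : ℝ) else 0) +
        (if ((i₁ = 0 ∧ i₂ = 1) ∨ (i₁ = 1 ∧ i₂ = 0)) ∧ i₃ = 0 then -(1 / 2) else 0) := fun _ _ _ => by simp [hα]
  -- symmetry (4.2)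
  have hsymm : IsSymmetricCoeff α := by
    intro i₁ i₂ i₃ μ₁ μ₂ μ₃ hμ
    rw [mem_shiftSet_iff] at hμ
    simp only [Prod.mk.injEq] at hμ
    rcases hμ with ⟨rfl, rfl, rfl⟩ | ⟨rfl, rfl, rfl⟩ | ⟨rfl, rfl, rfl⟩ | ⟨rfl, rfl, rfl⟩
    · simp only [hin]
      fin_cases i₁ <;> fin_cases i₂ <;> fin_cases i₃ <;> simp
    · simp only [hup1, hup2]
      fin_cases i₁ <;> fin_cases i₂ <;> fin_cases i₃ <;> simp
    · simp only [hup1, hup2]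
      fin_cases i₁ <;> fin_cases i₂ <;> fin_cases i₃ <;> simp
    · simp only [hfeed]
      fin_cases i₁ <;> fin_cases i₂ <;> fin_cases i₃ <;> simp
  -- cancellation (4.3)
  have hcanc : IsCancellingCoeff α := by
    intro i₁ i₂ i₃ μ₁ μ₂ μ₃ hμ
    rw [mem_shiftSet_iff] at hμ
    simp only [Prod.mk.injEq] at hμ
    rcases hμ with ⟨rfl, rfl, rfl⟩ | ⟨rfl, rfl, rfl⟩ | ⟨rfl, rfl, rfl⟩ | ⟨rfl, rfl, rfl⟩ <;>
      simp only [hin, hfeed, hup1, hup2] <;>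
      fin_cases i₁ <;> fin_cases i₂ <;> fin_cases i₃ <;> simp <;> norm_num
  -- `4`-comparability
  have hcomp : IsComparableCoeff 4 α := by
    intro i₁ i₂ i₃ μ hμ
    rw [mem_shiftSet_iff] at hμ
    rcases hμ with rfl | rfl | rfl | rfl <;>
      simp only [hin, hfeed, hup1, hup2] <;>
      fin_cases i₁ <;> fin_cases i₂ <;> fin_cases i₃ <;> simp <;> norm_num
  -- the orthant hypothesis of the crux
  have horth : ∀ (Y : Fin 4 → ℤ → ℝ → ℝ) (τ : ℝ), (∀ (j : Fin 4) (k : ℤ), 1 ≤ k → 0 ≤ Y j k τ) →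
      ∀ δ : ℝ, 0 < δ → ∀ (i : Fin 4) (n : ℤ), 1 ≤ n → Y i n τ = 0 → 0 ≤ quadTerm δ α Y i n τ := by
    rw [orthant_iff_coefficients]
    refine ⟨?_, ?_, ?_⟩
    · intro i w
      simp only [hfeed, Fin.sum_univ_four]
      fin_cases i
      · simp
        exact mul_self_nonneg _
      · simp
      · simp
      · simp
    · intro i a b hbi
      simp only [hup1, hup2]
      fin_cases i <;> fin_cases a <;> fin_cases b <;> simp at hbi ⊢
    · intro i y hy hyi
      simp only [hin, Fin.sum_univ_four]
      fin_cases i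
      · have h0 : y 0 = 0 := hyi
        simp [h0]
      · simp
        exact mul_self_nonneg _
      · simp
      · simp
  have hdiag : ∀ a b i : Fin 4, a ≠ b → α a b i (0, 0, 1) = 0 := by
    intro a b i hab
    rw [hfeed]
    fin_cases a <;> fin_cases b <;> simp at hab ⊢
  have hw : ∀ a c : Fin 4, α a a c (0, 0, 1) = if a = 0 ∧ c = 0 then (1 / 2 : ℝ) else 0 := by
    intro a c
    rw [hfeed]
    fin_cases a <;> fin_cases c <;> simp
  have hP : ∀ a c : Fin 4, a ≠ c → α a a c (0, 0, 0) = if a = 0 ∧ c = 1 then (1 : ℝ) else 0 := by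
    intro a c hac
    rw [hin]
    fin_cases a <;> fin_cases c <;> simp at hac ⊢
  have hCz : ∀ a b c : Fin 4, a ≠ b → a ≠ c → b ≠ c → α a b c (0, 0, 0) = 0 := by
    intro a b c hab hac hbc
    rw [hin]
    fin_cases a <;> fin_cases b <;> fin_cases c <;> simp at hab hac hbc ⊢
  exact ⟨α, ⟨hsymm, hcanc, hcomp⟩, horth, hdiag, hw, hP, hCz⟩

/-- **The starvation barrier instantiated on the witness**: a table of `E₂(4)`, orthant, on which `ShellBarrierAt R ε₀ α`
holds for every `R` and EVERY `ε₀ ∈ (0, 1]` (by `deadEndPump_shellBarrierAt`, `ε₀·(1/2)² < 1²`). [this file] -/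
theorem deadEndPump_nonempty_shellBarrierAt : ∃ α : Fin 4 → Fin 4 → Fin 4 → ℤ × ℤ × ℤ → ℝ,
    Literature.Analysis.FluidPDE.TaoCascade.InTableClass 4 α ∧
    (∀ (Y : Fin 4 → ℤ → ℝ → ℝ) (τ : ℝ), (∀ (j : Fin 4) (k : ℤ), 1 ≤ k → 0 ≤ Y j k τ) →
      ∀ δ : ℝ, 0 < δ → ∀ (i : Fin 4) (n : ℤ), 1 ≤ n → Y i n τ = 0 → 0 ≤ quadTerm δ α Y i n τ) ∧
    ∀ R ε₀ : ℝ, 0 < ε₀ → ε₀ ≤ 1 → ShellBarrierAt R ε₀ α := by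
  obtain ⟨α, hT, hO, hD, hw, hP, hCz⟩ := deadEndPump_nonempty
  refine ⟨α, hT, hO, fun R ε₀ hε hε1 => ?_⟩
  exact deadEndPump_shellBarrierAt hε (by norm_num) (by norm_num) (by nlinarith) hD hw hP hCz R

/-! ## §2 The leak-spray table `W 0 = 1/2`, `W 1 = 1`, `W 2 = W 3 = 0` -/

/-- **THE LEAK-SPRAY CLASS IS NON-EMPTY INSIDE THE CRUX'S HYPOTHESES, IN THE STARVATION RANGE**: a table of `E₂(4)`,
orthant, with diagonal feeds, chain weight `W 0 = 1/2` and one leak `W 1 = 1` (`r = 4 > ε₀` for every `ε₀ ≤ 1`), no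
in-shell coupling. [this file] -/
theorem leakSpray_nonempty : ∃ α : Fin 4 → Fin 4 → Fin 4 → ℤ × ℤ × ℤ → ℝ,
    Literature.Analysis.FluidPDE.TaoCascade.InTableClass 4 α ∧
    (∀ (Y : Fin 4 → ℤ → ℝ → ℝ) (τ : ℝ), (∀ (j : Fin 4) (k : ℤ), 1 ≤ k → 0 ≤ Y j k τ) →
      ∀ δ : ℝ, 0 < δ → ∀ (i : Fin 4) (n : ℤ), 1 ≤ n → Y i n τ = 0 → 0 ≤ quadTerm δ α Y i n τ) ∧
    (∀ a b i : Fin 4, a ≠ b → α a b i (0, 0, 1) = 0) ∧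
    (∀ a i : Fin 4, α a a i (0, 0, 1) = if a = 0 then (![1 / 2, 1, 0, 0] : Fin 4 → ℝ) i else 0) ∧
    (∀ a b i : Fin 4, α a b i (0, 0, 0) = 0) := by
  set α : Fin 4 → Fin 4 → Fin 4 → ℤ × ℤ × ℤ → ℝ := fun i₁ i₂ i₃ μ =>
    if μ = ((0 : ℤ), (0 : ℤ), (1 : ℤ)) then
      ((if i₁ = 0 ∧ i₂ = 0 ∧ i₃ = 0 then (1 / 2 : ℝ) else 0) + (if i₁ = 0 ∧ i₂ = 0 ∧ i₃ = 1 then 1 else 0))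
    else if μ = ((1 : ℤ), (0 : ℤ), (0 : ℤ)) then
      ((if i₁ = 0 ∧ i₂ = 0 ∧ i₃ = 0 then (-(1 / 4) : ℝ) else 0) + (if i₁ = 1 ∧ i₂ = 0 ∧ i₃ = 0 then -(1 / 2) else 0))
    else if μ = ((0 : ℤ), (1 : ℤ), (0 : ℤ)) then
      ((if i₁ = 0 ∧ i₂ = 0 ∧ i₃ = 0 then (-(1 / 4) : ℝ) else 0) + (if i₁ = 0 ∧ i₂ = 1 ∧ i₃ = 0 then -(1 / 2) else 0))
    else 0 with hα
  have hfeed : ∀ i₁ i₂ i₃ : Fin 4, α i₁ i₂ i₃ ((0 : ℤ), (0 : ℤ), (1 : ℤ)) =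
      (if i₁ = 0 ∧ i₂ = 0 ∧ i₃ = 0 then (1 / 2 : ℝ) else 0) + (if i₁ = 0 ∧ i₂ = 0 ∧ i₃ = 1 then 1 else 0) :=
    fun _ _ _ => by simp [hα]
  have hup1 : ∀ i₁ i₂ i₃ : Fin 4, α i₁ i₂ i₃ ((1 : ℤ), (0 : ℤ), (0 : ℤ)) =
      (if i₁ = 0 ∧ i₂ = 0 ∧ i₃ = 0 then (-(1 / 4) : ℝ) else 0) + (if i₁ = 1 ∧ i₂ = 0 ∧ i₃ = 0 then -(1 / 2) else 0) :=
    fun _ _ _ => by simp [hα]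
  have hup2 : ∀ i₁ i₂ i₃ : Fin 4, α i₁ i₂ i₃ ((0 : ℤ), (1 : ℤ), (0 : ℤ)) =
      (if i₁ = 0 ∧ i₂ = 0 ∧ i₃ = 0 then (-(1 / 4) : ℝ) else 0) + (if i₁ = 0 ∧ i₂ = 1 ∧ i₃ = 0 then -(1 / 2) else 0) :=
    fun _ _ _ => by simp [hα]
  have hin : ∀ i₁ i₂ i₃ : Fin 4, α i₁ i₂ i₃ ((0 : ℤ), (0 : ℤ), (0 : ℤ)) = 0 := fun _ _ _ => by simp [hα]
  have hsymm : IsSymmetricCoeff α := by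
    intro i₁ i₂ i₃ μ₁ μ₂ μ₃ hμ
    rw [mem_shiftSet_iff] at hμ
    simp only [Prod.mk.injEq] at hμ
    rcases hμ with ⟨rfl, rfl, rfl⟩ | ⟨rfl, rfl, rfl⟩ | ⟨rfl, rfl, rfl⟩ | ⟨rfl, rfl, rfl⟩
    · simp only [hin]
    · simp only [hup1, hup2]
      fin_cases i₁ <;> fin_cases i₂ <;> fin_cases i₃ <;> simp
    · simp only [hup1, hup2]
      fin_cases i₁ <;> fin_cases i₂ <;> fin_cases i₃ <;> simp
    · simp only [hfeed]
      fin_cases i₁ <;> fin_cases i₂ <;> fin_cases i₃ <;> simp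
  have hcanc : IsCancellingCoeff α := by
    intro i₁ i₂ i₃ μ₁ μ₂ μ₃ hμ
    rw [mem_shiftSet_iff] at hμ
    simp only [Prod.mk.injEq] at hμ
    rcases hμ with ⟨rfl, rfl, rfl⟩ | ⟨rfl, rfl, rfl⟩ | ⟨rfl, rfl, rfl⟩ | ⟨rfl, rfl, rfl⟩ <;>
      simp only [hin, hfeed, hup1, hup2] <;>
      fin_cases i₁ <;> fin_cases i₂ <;> fin_cases i₃ <;> simp <;> norm_num
  have hcomp : IsComparableCoeff 4 α := by
    intro i₁ i₂ i₃ μ hμ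
    rw [mem_shiftSet_iff] at hμ
    rcases hμ with rfl | rfl | rfl | rfl <;>
      simp only [hin, hfeed, hup1, hup2] <;>
      fin_cases i₁ <;> fin_cases i₂ <;> fin_cases i₃ <;> simp <;> norm_num
  have horth : ∀ (Y : Fin 4 → ℤ → ℝ → ℝ) (τ : ℝ), (∀ (j : Fin 4) (k : ℤ), 1 ≤ k → 0 ≤ Y j k τ) →
      ∀ δ : ℝ, 0 < δ → ∀ (i : Fin 4) (n : ℤ), 1 ≤ n → Y i n τ = 0 → 0 ≤ quadTerm δ α Y i n τ := by
    rw [orthant_iff_coefficients]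
    refine ⟨?_, ?_, ?_⟩
    · intro i w
      simp only [hfeed, Fin.sum_univ_four]
      fin_cases i
      · simp
        exact mul_self_nonneg _
      · simp
        exact mul_self_nonneg _
      · simp
      · simp
    · intro i a b hbi
      simp only [hup1, hup2]
      fin_cases i <;> fin_cases a <;> fin_cases b <;> simp at hbi ⊢
    · intro i y hy hyi
      simp only [hin, Fin.sum_univ_four]
      simp
  have hdiag : ∀ a b i : Fin 4, a ≠ b → α a b i (0, 0, 1) = 0 := by
    intro a b i hab
    rw [hfeed]
    fin_cases a <;> fin_cases b <;> simp at hab ⊢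
  have hW : ∀ a i : Fin 4, α a a i (0, 0, 1) = if a = 0 then (![1 / 2, 1, 0, 0] : Fin 4 → ℝ) i else 0 := by
    intro a i
    rw [hfeed]
    fin_cases a <;> fin_cases i <;> simp
  exact ⟨α, ⟨hsymm, hcanc, hcomp⟩, horth, hdiag, hW, hin⟩

/-- **The starvation barrier instantiated on the leak-spray witness**: a table of `E₂(4)`, orthant, on which
`ShellBarrierAt R ε₀ α` holds for every `R` and EVERY `ε₀ ∈ (0, 1]` (by `leakSpray_shellBarrierAt`, `ε₀·(1/2)² < 1²`).
[this file] -/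
theorem leakSpray_nonempty_shellBarrierAt : ∃ α : Fin 4 → Fin 4 → Fin 4 → ℤ × ℤ × ℤ → ℝ,
    Literature.Analysis.FluidPDE.TaoCascade.InTableClass 4 α ∧
    (∀ (Y : Fin 4 → ℤ → ℝ → ℝ) (τ : ℝ), (∀ (j : Fin 4) (k : ℤ), 1 ≤ k → 0 ≤ Y j k τ) →
      ∀ δ : ℝ, 0 < δ → ∀ (i : Fin 4) (n : ℤ), 1 ≤ n → Y i n τ = 0 → 0 ≤ quadTerm δ α Y i n τ) ∧
    ∀ R ε₀ : ℝ, 0 < ε₀ → ε₀ ≤ 1 → ShellBarrierAt R ε₀ α := by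
  obtain ⟨α, hT, hO, hD, hW, hIn⟩ := leakSpray_nonempty
  refine ⟨α, hT, hO, fun R ε₀ hε hε1 => ?_⟩
  refine leakSpray_shellBarrierAt (W := (![1 / 2, 1, 0, 0] : Fin 4 → ℝ)) hε (by simp) ?_ ?_ hD hW hIn R
  · intro i
    fin_cases i <;> simp
  · simp
    nlinarith

end Summit.NavierStokesRegularity.NavierStokesRegularity.Theorems

end
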